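import Summits.MatrixMultiplication.MatrixMultiplication.Theorems.SoloInformedTwistedMatchingsBehrend
import Literature.Combinatorics.Additive.SliceRankMethod
import Mathlib.Combinatorics.Additive.AP.Three.Behrend
import Mathlib.Analysis.SpecialFunctions.Pow.Real
import HarnessLib

/-!
# The support-subrank principle for coherent-configuration realizations, and the direct powers of
# the trivial scheme (Theorem S)

Solo-informed seat (MatrixMultiplication), gen 109 (paper/theoremB2.md §9; sharpest-statement §2y(15)).

**Principle (`realization_card_le_of_hasSliceRankLE`).** A Cohn–Umans realization of `⟨n,n,n⟩`
(CU13, Def. 12) in a coherent configuration sees only the TRIANGLE SUPPORT `Tri ⊆ Cl³` of the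
configuration: the maps `α, β, γ : [n]² → Cl` satisfy `Tri(α x, β y, γ z) ⟺ (x,y,z)` is a
matrix-multiplication triple. Hence for EVERY field `K` and EVERY tensor `Z : Cl³ → K` whose support
is exactly `Tri`, every induced matching of `supp ⟨n,n,n⟩` pulls back to a diagonal of `Z` with
non-zero entries, and Tao's lemma gives `|matching| ≤ slicerank_K(Z)`; with the corner matchings of
size `r₃(N)·N` (`threeAPFree_inducedMatching`) and Behrend, `N² e^{-4√log N} ≤ slicerank_K(Z)` for
`n = 3N` (`realization_behrend_le_of_hasSliceRankLE`). Over `ℂ` the structural tensor of a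
commutative rank-`r` configuration is `≅ ⟨r⟩` and gives nothing beyond `n² ≤ r`; the point is that
one may RE-WEIGHT the support and CHANGE THE FIELD.

**Theorem S (`supportPower_realization_behrend_le`).** The `k`-th direct power of the trivial
rank-2 scheme on `q ≥ 3` points (= the translation scheme `𝒮(F^k, (Fˣ)^k)`, `|F| = q`; rank `2^k`)
has classes `2^[k]` (supports) and triangle support `GOOD^k`, `GOOD(x,y,z) :⟺ x+y+z ≠ 1` on bits
(`supportPower_triangle_iff_good` is the dictionary for `𝒮(F^k,(Fˣ)^k)`). The rational tensor
`zg = e₀₀₀+e₀₁₁+e₁₀₁−e₁₁₀+2e₁₁₁` has support exactly `GOOD` and is a W-tensor: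
`zg(x,y,z) = [x=1]·s(z) + [y=1]·s(z) + [z=0]`, `s = [·=1]−[·=0]`. Expanding `zg^{⊗k}` over
`ω : [k] → Fin 3` and sorting each term by its least-frequent colour (Tao) gives
`slicerank(zg^{⊗k}) ≤ 3·#{A ⊆ [k] : 3|A| ≤ k} ≤ 3·(2^{1/3}·3/2)^k = 3·1.88988^k`. Consequently a
realization of `⟨3N,3N,3N⟩` in the `k`-th power of the trivial scheme forces
`N² e^{-4√log N} ≤ 3·2^{k/3}(3/2)^k`, i.e. rank `2^k ≥ n^{2/log₂(1.88988…) - o(1)} = n^{2.178-o(1)}`: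
Cohn–Umans Conj. 21 fails on the direct powers of the trivial scheme (the only bound available
before was the s-rank bound `2^k ≥ n²`).

References: CohnUmans2013 (arXiv:1207.6528) Def. 12, Prop. 9, §5, Conj. 21;
BlasiakChurchCohnGrochowNaslundSawinUmans2017 (arXiv:1605.06702) §4.1, Lemma 4.7, Prop. 4.8;
Tao (2016, slice rank); ChristandlVranaZuiddam2018 (arXiv:1709.07851: `Q̃(W) = 2^{h(1/3)}`).
-/

noncomputable section

open scoped BigOperators
open Finset Literature.Combinatorics.Additive

namespace Summit.MatrixMultiplication.MatrixMultiplication.Theorems.SupportSubrank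

open Summit.MatrixMultiplication.MatrixMultiplication.Theorems.TwistedSliceRank
  (threeAPFree_inducedMatching)

/-! ## §1 The principle: realizations pull induced matchings back to diagonals of any re-weighting -/

section Principle

variable {Cl : Type*} {K : Type*} [Field K]

/-- **Support-subrank principle.** If `α, β, γ : [n]² → Cl` realize `⟨n,n,n⟩` for the triangle
predicate `Tri` (`Tri(α x, β y, γ z) ⟺ (x,y,z)` is a matrix-multiplication triple) and `Z` is any
tensor over any field with support exactly `Tri`, then every induced matching
`(a_i,b_i,c_i)_{i ∈ ι}` of `supp ⟨n,n,n⟩` has `|ι| ≤ r` whenever `slicerank Z ≤ r`. [this work] -/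
theorem realization_card_le_of_hasSliceRankLE (Tri : Cl → Cl → Cl → Prop) (Z : Cl → Cl → Cl → K)
    (hZ : ∀ u v w, Z u v w ≠ 0 ↔ Tri u v w) {r : ℕ} (hr : HasSliceRankLE Z r) {n : ℕ}
    (α β γ : Fin n × Fin n → Cl)
    (hreal : ∀ x y z : Fin n × Fin n, Tri (α x) (β y) (γ z) ↔ (y.1 = x.2 ∧ z = (y.2, x.1)))
    {ι : Type*} [Fintype ι] (a b c : ι → Fin n)
    (hind : ∀ i j l, b j = b i → c l = c j → a l = a i → i = j ∧ j = l) :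
    Fintype.card ι ≤ r := by
  refine hr.card_le_of_matching (fun i => α (a i, b i)) (fun j => β (b j, c j))
    (fun l => γ (c l, a l)) fun i j l => ?_
  rw [hZ, hreal]
  constructor
  · rintro ⟨h1, h2⟩
    simp only [Prod.mk.injEq] at h2
    exact hind i j l h1 h2.1 h2.2
  · rintro ⟨rfl, rfl⟩
    exact ⟨rfl, rfl⟩

/-- Roth form: a realization of `⟨3N,3N,3N⟩` forces `r₃(N)·N ≤ slicerank_K(Z)` for every field `K`
and every `Z` with support `Tri`. [this work] -/
theorem realization_roth_le_of_hasSliceRankLE (Tri : Cl → Cl → Cl → Prop) (Z : Cl → Cl → Cl → K)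
    (hZ : ∀ u v w, Z u v w ≠ 0 ↔ Tri u v w) {r : ℕ} (hr : HasSliceRankLE Z r) (N : ℕ)
    (α β γ : Fin (3 * N) × Fin (3 * N) → Cl)
    (hreal : ∀ x y z : Fin (3 * N) × Fin (3 * N),
      Tri (α x) (β y) (γ z) ↔ (y.1 = x.2 ∧ z = (y.2, x.1))) :
    rothNumberNat N * N ≤ r := by
  classical
  obtain ⟨t, htN, htcard, ht⟩ := rothNumberNat_spec N
  obtain ⟨a, b, c, -, hind⟩ := threeAPFree_inducedMatching ht htN
  have h := realization_card_le_of_hasSliceRankLE Tri Z hZ hr α β γ hreal a b c hind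
  have hcard : Fintype.card (↥t × Fin N) = rothNumberNat N * N := by
    rw [Fintype.card_prod, Fintype.card_coe, htcard, Fintype.card_fin]
  rwa [hcard] at h

/-- Behrend form: `N² e^{-4√(log N)} ≤ slicerank_K(Z)`. [this work] -/
theorem realization_behrend_le_of_hasSliceRankLE (Tri : Cl → Cl → Cl → Prop)
    (Z : Cl → Cl → Cl → K) (hZ : ∀ u v w, Z u v w ≠ 0 ↔ Tri u v w) {r : ℕ}
    (hr : HasSliceRankLE Z r) (N : ℕ) (α β γ : Fin (3 * N) × Fin (3 * N) → Cl)
    (hreal : ∀ x y z : Fin (3 * N) × Fin (3 * N),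
      Tri (α x) (β y) (γ z) ↔ (y.1 = x.2 ∧ z = (y.2, x.1))) :
    (N : ℝ) ^ 2 * Real.exp (-4 * Real.sqrt (Real.log N)) ≤ r := by
  have h := realization_roth_le_of_hasSliceRankLE Tri Z hZ hr N α β γ hreal
  have hB : (N : ℝ) * Real.exp (-4 * Real.sqrt (Real.log N)) ≤ rothNumberNat N :=
    Behrend.roth_lower_bound
  have hN : (0 : ℝ) ≤ N := Nat.cast_nonneg N
  calc (N : ℝ) ^ 2 * Real.exp (-4 * Real.sqrt (Real.log N))
      = ((N : ℝ) * Real.exp (-4 * Real.sqrt (Real.log N))) * N := by ring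
    _ ≤ (rothNumberNat N : ℝ) * N := mul_le_mul_of_nonneg_right hB hN
    _ ≤ r := by exact_mod_cast h

end Principle

/-! ## §2 The golden tensor: a W-tensor whose support is the triangle relation of the trivial scheme -/

section Golden

/-- One coordinate of the triangle relation of the powers of the trivial scheme (`q ≥ 3`): the bits
`x, y, z` (is the coordinate in the support?) are NOT of Hamming weight exactly one. [this work] -/
def Good (x y z : Fin 2) : Prop := x.val + y.val + z.val ≠ 1

/-- `[x = 1]`. -/
def e₁ (x : Fin 2) : ℚ := if x = 1 then 1 else 0
/-- `[x = 0]`. -/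
def e₀ (x : Fin 2) : ℚ := if x = 0 then 1 else 0
/-- `s = [·=1] − [·=0]`. -/
def sg (x : Fin 2) : ℚ := if x = 1 then 1 else -1

/-- The three rank-one terms of the W-form: colour `0` marks `x`, colour `1` marks `y`, colour `2`
marks `z`. -/
def fx (a : Fin 3) (x : Fin 2) : ℚ := if a = 0 then e₁ x else 1
/-- see `fx`. -/
def fy (a : Fin 3) (y : Fin 2) : ℚ := if a = 1 then e₁ y else 1
/-- see `fx`. -/
def fz (a : Fin 3) (z : Fin 2) : ℚ := if a = 2 then e₀ z else sg z

/-- **The golden tensor** `zg = e₀₀₀ + e₀₁₁ + e₁₀₁ − e₁₁₀ + 2e₁₁₁`, written in W-form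
`zg(x,y,z) = Σ_{a<3} fx_a(x) fy_a(y) fz_a(z) = [x=1]s(z) + [y=1]s(z) + [z=0]`. [this work] -/
def zg (x y z : Fin 2) : ℚ := ∑ a : Fin 3, fx a x * fy a y * fz a z

/-- The support of `zg` is exactly `Good`. [this work] -/
theorem zg_ne_zero_iff (x y z : Fin 2) : zg x y z ≠ 0 ↔ Good x y z := by
  fin_cases x <;> fin_cases y <;> fin_cases z <;>
    simp [zg, fx, fy, fz, e₁, e₀, sg, Good, Fin.sum_univ_three]

variable {k : ℕ}

/-- The `k`-th Kronecker power of `zg`, on bit-vectors `[k] → Fin 2` (= supports `⊆ [k]`). -/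
def zgPow (k : ℕ) (u v w : Fin k → Fin 2) : ℚ := ∏ ℓ, zg (u ℓ) (v ℓ) (w ℓ)

/-- The support of `zg^{⊗k}` is `GOOD^k`, the triangle relation of the `k`-th power of the trivial
scheme. [this work] -/
theorem zgPow_ne_zero_iff (u v w : Fin k → Fin 2) :
    zgPow k u v w ≠ 0 ↔ ∀ ℓ, Good (u ℓ) (v ℓ) (w ℓ) := by
  unfold zgPow
  rw [Finset.prod_ne_zero_iff]
  simp only [Finset.mem_univ, forall_true_left, zg_ne_zero_iff]

/-- Rank-one expansion of the Kronecker power over colourings `ω : [k] → Fin 3`. -/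
theorem zgPow_eq_sum (u v w : Fin k → Fin 2) :
    zgPow k u v w = ∑ ω : Fin k → Fin 3,
      (∏ ℓ, fx (ω ℓ) (u ℓ)) * (∏ ℓ, fy (ω ℓ) (v ℓ)) * ∏ ℓ, fz (ω ℓ) (w ℓ) := by
  unfold zgPow zg
  rw [Fintype.prod_sum]
  refine Finset.sum_congr rfl fun ω _ => ?_
  rw [Finset.prod_mul_distrib, Finset.prod_mul_distrib]

/-- The small subsets of `[k]`: `3|A| ≤ k`. -/
abbrev Low (k : ℕ) : Type := {A : Finset (Fin k) // 3 * A.card ≤ k}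

/-- `|Low k| = #{A ⊆ [k] : 3|A| ≤ k}`. -/
theorem card_low (k : ℕ) :
    Fintype.card (Low k) =
      ((univ : Finset (Finset (Fin k))).filter fun A => 3 * A.card ≤ k).card := by
  rw [Fintype.card_subtype]

/-- the colour class of `ω` of colour `a`. -/
def cls (ω : Fin k → Fin 3) (a : Fin 3) : Finset (Fin k) := univ.filter fun ℓ => ω ℓ = a

/-- the three colour classes partition `[k]`. -/
theorem card_cls_sum (ω : Fin k → Fin 3) :
    (cls ω 0).card + (cls ω 1).card + (cls ω 2).card = k := by
  classical
  have h := Finset.card_eq_sum_card_fiberwise (s := (univ : Finset (Fin k))) (t := (univ : Finset (Fin 3)))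
    (f := ω) (fun _ _ => mem_univ _)
  rw [card_univ, Fintype.card_fin, Fin.sum_univ_three] at h
  simpa [cls] using h.symm

/-- Tao's colouring: a colour whose class has at most `k/3` elements. -/
def colour (ω : Fin k → Fin 3) : Fin 3 :=
  if 3 * (cls ω 0).card ≤ k then 0 else if 3 * (cls ω 1).card ≤ k then 1 else 2

/-- the chosen colour class is small (pigeonhole). -/
theorem colour_small (ω : Fin k → Fin 3) : 3 * (cls ω (colour ω)).card ≤ k := by
  unfold colour
  split_ifs with h0 h1
  · exact h0
  · exact h1
  · have := card_cls_sum ω; omega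

/-- compression map to the small colour class (junk `∅` when the class is large). -/
def πcls (ω : Fin k → Fin 3) (a : Fin 3) : Low k :=
  if h : 3 * (cls ω a).card ≤ k then ⟨cls ω a, h⟩ else ⟨∅, by simp⟩

/-- on a small class the compression map is the class itself. -/
theorem πcls_val (ω : Fin k → Fin 3) (a : Fin 3) (h : 3 * (cls ω a).card ≤ k) :
    (πcls ω a).1 = cls ω a := by
  simp [πcls, h]

/-- **Tao's bound for the golden power**: `slicerank(zg^{⊗k}) ≤ 3 · #{A ⊆ [k] : 3|A| ≤ k}`.
[this work; the argument is Tao's for `W^{⊗k}`] -/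
theorem hasSliceRankLE_zgPow (k : ℕ) : HasSliceRankLE (zgPow k) (3 * Fintype.card (Low k)) := by
  classical
  have h := hasSliceRankLE_of_cover (K := ℚ) (zgPow k)
    (fun (ω : Fin k → Fin 3) (u : Fin k → Fin 2) => ∏ ℓ, fx (ω ℓ) (u ℓ))
    (fun ω v => ∏ ℓ, fy (ω ℓ) (v ℓ)) (fun ω w => ∏ ℓ, fz (ω ℓ) (w ℓ)) (zgPow_eq_sum) colour
    (Sx := Low k) (Sy := Low k) (Sz := Low k)
    (fun ω => πcls ω 0) (fun A u => ∏ ℓ, if ℓ ∈ A.1 then e₁ (u ℓ) else 1) ?_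
    (fun ω => πcls ω 1) (fun A v => ∏ ℓ, if ℓ ∈ A.1 then e₁ (v ℓ) else 1) ?_
    (fun ω => πcls ω 2) (fun A w => ∏ ℓ, if ℓ ∈ A.1 then e₀ (w ℓ) else sg (w ℓ)) ?_
  · have e : Fintype.card (Low k) + Fintype.card (Low k) + Fintype.card (Low k) =
        3 * Fintype.card (Low k) := by ring
    rwa [e] at h
  · intro ω hω
    have hs : 3 * (cls ω 0).card ≤ k := by simpa [hω] using colour_small ω
    funext u
    refine Finset.prod_congr rfl fun ℓ _ => ?_
    simp [πcls_val ω 0 hs, cls, fx]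
  · intro ω hω
    have hs : 3 * (cls ω 1).card ≤ k := by simpa [hω] using colour_small ω
    funext v
    refine Finset.prod_congr rfl fun ℓ _ => ?_
    simp [πcls_val ω 1 hs, cls, fy]
  · intro ω hω
    have hs : 3 * (cls ω 2).card ≤ k := by simpa [hω] using colour_small ω
    funext w
    refine Finset.prod_congr rfl fun ℓ _ => ?_
    simp [πcls_val ω 2 hs, cls, fz]

/-- **Entropy bound** `#{A ⊆ [k] : 3|A| ≤ k} ≤ 2^{k/3}·(3/2)^k = (1.88988…)^k` (the value
`2^{h(1/3)k}`; Chernoff with parameter `1/2`). [this work] -/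
theorem card_low_le (k : ℕ) :
    (Fintype.card (Low k) : ℝ) ≤ (2 : ℝ) ^ ((k : ℝ) / 3) * (3 / 2 : ℝ) ^ k := by
  classical
  rw [card_low]
  set S := (univ : Finset (Finset (Fin k))).filter fun A => 3 * A.card ≤ k with hS
  -- Σ_{A ⊆ [k]} (1/2)^{|A|} = (3/2)^k
  have hbin : ∑ A : Finset (Fin k), (1 / 2 : ℝ) ^ A.card = (3 / 2 : ℝ) ^ k := by
    have h := Finset.sum_pow_mul_eq_add_pow (1 / 2 : ℝ) 1 (univ : Finset (Fin k))
    simp only [one_pow, mul_one, card_univ, Fintype.card_fin, powerset_univ] at h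
    rw [h]; norm_num
  -- each small A contributes at least (1/2)^{k/3}
  have hlow : ∀ A ∈ S, (1 / 2 : ℝ) ^ ((k : ℝ) / 3) ≤ (1 / 2 : ℝ) ^ A.card := by
    intro A hA
    rw [hS, mem_filter] at hA
    rw [← Real.rpow_natCast]
    apply Real.rpow_le_rpow_of_exponent_ge (by norm_num) (by norm_num)
    have : (3 : ℝ) * A.card ≤ k := by exact_mod_cast hA.2
    linarith
  have h1 : (S.card : ℝ) * (1 / 2 : ℝ) ^ ((k : ℝ) / 3) ≤ ∑ A ∈ S, (1 / 2 : ℝ) ^ A.card := by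
    rw [← nsmul_eq_mul]
    exact Finset.card_nsmul_le_sum S _ _ hlow
  have h2 : ∑ A ∈ S, (1 / 2 : ℝ) ^ A.card ≤ ∑ A : Finset (Fin k), (1 / 2 : ℝ) ^ A.card :=
    Finset.sum_le_sum_of_subset_of_nonneg (Finset.filter_subset _ _) fun _ _ _ => by positivity
  have hpos : (0 : ℝ) < (1 / 2 : ℝ) ^ ((k : ℝ) / 3) := by positivity
  have h3 : (S.card : ℝ) ≤ (3 / 2 : ℝ) ^ k / (1 / 2 : ℝ) ^ ((k : ℝ) / 3) := by
    rw [le_div_iff₀ hpos]; linarith [h1, h2, hbin]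
  have h4 : (3 / 2 : ℝ) ^ k / (1 / 2 : ℝ) ^ ((k : ℝ) / 3) = (2 : ℝ) ^ ((k : ℝ) / 3) * (3 / 2 : ℝ) ^ k := by
    rw [Real.div_rpow (by norm_num) (by norm_num), Real.one_rpow]
    field_simp
  linarith [h3, h4.le]

end Golden

/-! ## §3 Theorem S: the direct powers of the trivial scheme -/

section TheoremS

variable {k : ℕ}

/-- **Theorem S (matching form).** If `α, β, γ : [n]² → 2^[k]` realize `⟨n,n,n⟩` in the `k`-th
power of the trivial scheme (triangle relation `GOOD^k`), every induced matching of
`supp ⟨n,n,n⟩` has at most `3·#{A ⊆ [k] : 3|A| ≤ k}` elements. [this work] -/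
theorem supportPower_realization_card_le {n : ℕ} (α β γ : Fin n × Fin n → (Fin k → Fin 2))
    (hreal : ∀ x y z : Fin n × Fin n,
      (∀ ℓ, Good (α x ℓ) (β y ℓ) (γ z ℓ)) ↔ (y.1 = x.2 ∧ z = (y.2, x.1)))
    {ι : Type*} [Fintype ι] (a b c : ι → Fin n)
    (hind : ∀ i j l, b j = b i → c l = c j → a l = a i → i = j ∧ j = l) :
    Fintype.card ι ≤ 3 * Fintype.card (Low k) :=
  realization_card_le_of_hasSliceRankLE (fun u v w => ∀ ℓ, Good (u ℓ) (v ℓ) (w ℓ)) (zgPow k)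
    zgPow_ne_zero_iff (hasSliceRankLE_zgPow k) α β γ hreal a b c hind

/-- **Theorem S (Roth form).** A realization of `⟨3N,3N,3N⟩` in the `k`-th power of the trivial
scheme forces `r₃(N)·N ≤ 3·#{A ⊆ [k] : 3|A| ≤ k}`. [this work] -/
theorem supportPower_realization_roth_le (N : ℕ)
    (α β γ : Fin (3 * N) × Fin (3 * N) → (Fin k → Fin 2))
    (hreal : ∀ x y z : Fin (3 * N) × Fin (3 * N),
      (∀ ℓ, Good (α x ℓ) (β y ℓ) (γ z ℓ)) ↔ (y.1 = x.2 ∧ z = (y.2, x.1))) :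
    rothNumberNat N * N ≤ 3 * Fintype.card (Low k) :=
  realization_roth_le_of_hasSliceRankLE (fun u v w => ∀ ℓ, Good (u ℓ) (v ℓ) (w ℓ)) (zgPow k)
    zgPow_ne_zero_iff (hasSliceRankLE_zgPow k) N α β γ hreal

/-- **Theorem S (Behrend form): the direct powers of the trivial scheme are polynomially wasteful.**
A realization of `⟨3N,3N,3N⟩` in the `k`-th power of the trivial scheme (rank `2^k`) forces
`N² e^{-4√(log N)} ≤ 3 · 2^{k/3} · (3/2)^k = 3·(1.88988…)^k`; equivalently the rank is at least
`n^{2/log₂ 1.88988… − o(1)} = n^{2.178−o(1)}`, so Cohn–Umans Conj. 21 cannot be met by this family.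
[this work] -/
theorem supportPower_realization_behrend_le (N : ℕ)
    (α β γ : Fin (3 * N) × Fin (3 * N) → (Fin k → Fin 2))
    (hreal : ∀ x y z : Fin (3 * N) × Fin (3 * N),
      (∀ ℓ, Good (α x ℓ) (β y ℓ) (γ z ℓ)) ↔ (y.1 = x.2 ∧ z = (y.2, x.1))) :
    (N : ℝ) ^ 2 * Real.exp (-4 * Real.sqrt (Real.log N)) ≤
      3 * ((2 : ℝ) ^ ((k : ℝ) / 3) * (3 / 2 : ℝ) ^ k) := by
  have h := realization_behrend_le_of_hasSliceRankLE (fun u v w => ∀ ℓ, Good (u ℓ) (v ℓ) (w ℓ))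
    (zgPow k) zgPow_ne_zero_iff (hasSliceRankLE_zgPow k) N α β γ hreal
  have hc := card_low_le k
  push_cast at h
  linarith

end TheoremS

/-! ## §4 Dictionary: the translation scheme `𝒮(F^k, (Fˣ)^k)` has triangle relation `GOOD^k` -/

section Dictionary

variable {F : Type*} [Field F] [DecidableEq F] {k : ℕ}

/-- the support bit of a field element. -/
def bit (a : F) : Fin 2 := if a = 0 then 0 else 1

/-- One coordinate: for a field with at least three elements, `a + d·b + e·c = 0` is solvable in
UNITS `d, e` iff the support bits of `a, b, c` are not of weight exactly one. [this work] -/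
theorem exists_units_iff_good (hF : ∃ t : F, t ≠ 0 ∧ t ≠ 1) (a b c : F) :
    (∃ d e : F, d ≠ 0 ∧ e ≠ 0 ∧ a + d * b + e * c = 0) ↔ Good (bit a) (bit b) (bit c) := by
  obtain ⟨t, ht0, ht1⟩ := hF
  unfold Good bit
  constructor
  · rintro ⟨d, e, hd, he, h⟩
    split_ifs with ha hb hc hc hb hc hc <;> simp_all
  · intro hg
    by_cases ha : a = 0 <;> by_cases hb : b = 0 <;> by_cases hc : c = 0 <;>
      simp only [ha, hb, hc, if_true, if_false] at hg ⊢
    · exact ⟨1, 1, one_ne_zero, one_ne_zero, by simp⟩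
    · exact absurd hg (by decide)
    · exact absurd hg (by decide)
    · -- a = 0, b ≠ 0, c ≠ 0 : d = 1, e = -b/c
      refine ⟨1, -b / c, one_ne_zero, ?_, ?_⟩
      · exact div_ne_zero (neg_ne_zero.2 hb) hc
      · field_simp; ring
    · exact absurd hg (by decide)
    · -- a ≠ 0, b = 0, c ≠ 0 : e = -a/c
      refine ⟨1, -a / c, one_ne_zero, ?_, ?_⟩
      · exact div_ne_zero (neg_ne_zero.2 ha) hc
      · field_simp; ring
    · -- a ≠ 0, b ≠ 0, c = 0 : d = -a/b
      refine ⟨-a / b, 1, ?_, one_ne_zero, ?_⟩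
      · exact div_ne_zero (neg_ne_zero.2 ha) hb
      · field_simp; ring
    · -- all three non-zero: pick d with d·b ≠ -a among {1, t}·(−a/b)… concretely try d₀ = -a/b·t
      -- then d₀ b = -a t ≠ -a since t ≠ 1; e = (-a - d₀ b)/c = -a(1-t)/c ≠ 0.
      refine ⟨-a / b * t, -(a * (1 - t)) / c, ?_, ?_, ?_⟩
      · exact mul_ne_zero (div_ne_zero (neg_ne_zero.2 ha) hb) ht0
      · refine div_ne_zero (neg_ne_zero.2 (mul_ne_zero ha (sub_ne_zero.2 (Ne.symm ht1)))) hc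
      · field_simp; ring

/-- **Dictionary.** In the translation scheme `𝒮(F^k, (Fˣ)^k)` (`|F| ≥ 3`) — the `k`-th direct
power of the trivial scheme on `|F|` points — representatives `a, b, c ∈ F^k` of three classes form
a triangle (`a + d•b + e•c = 0` for some diagonal units `d, e`, cf. `triangle_iff_twisted`) iff their
supports satisfy `GOOD` coordinatewise. [this work] -/
theorem supportPower_triangle_iff_good (hF : ∃ t : F, t ≠ 0 ∧ t ≠ 1) (a b c : Fin k → F) :
    (∃ d e : Fin k → F, (∀ ℓ, d ℓ ≠ 0) ∧ (∀ ℓ, e ℓ ≠ 0) ∧ ∀ ℓ, a ℓ + d ℓ * b ℓ + e ℓ * c ℓ = 0) ↔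
      ∀ ℓ, Good (bit (a ℓ)) (bit (b ℓ)) (bit (c ℓ)) := by
  constructor
  · rintro ⟨d, e, hd, he, h⟩ ℓ
    exact (exists_units_iff_good hF _ _ _).1 ⟨d ℓ, e ℓ, hd ℓ, he ℓ, h ℓ⟩
  · intro h
    choose d e hd he hdec using fun ℓ => (exists_units_iff_good hF _ _ _).2 (h ℓ)
    exact ⟨d, e, hd, he, hdec⟩

/-- **Theorem S for `𝒮(F^k, (Fˣ)^k)` (Behrend form).** If `a, b, c : [3N]² → F^k` realize
`⟨3N,3N,3N⟩` in the translation scheme `𝒮(F^k,(Fˣ)^k)`, `|F| ≥ 3` — i.e. some diagonal-unit twist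
`a(x) + d•b(y) + e•c(z)` vanishes iff `(x,y,z)` is a matrix-multiplication triple — then
`N² e^{-4√(log N)} ≤ 3·2^{k/3}(3/2)^k` although the rank is `2^k`. [this work] -/
theorem diagonalUnitScheme_realization_behrend_le (hF : ∃ t : F, t ≠ 0 ∧ t ≠ 1) (N : ℕ)
    (a b c : Fin (3 * N) × Fin (3 * N) → (Fin k → F))
    (hreal : ∀ x y z : Fin (3 * N) × Fin (3 * N),
      (∃ d e : Fin k → F, (∀ ℓ, d ℓ ≠ 0) ∧ (∀ ℓ, e ℓ ≠ 0) ∧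
          ∀ ℓ, a x ℓ + d ℓ * b y ℓ + e ℓ * c z ℓ = 0) ↔ (y.1 = x.2 ∧ z = (y.2, x.1))) :
    (N : ℝ) ^ 2 * Real.exp (-4 * Real.sqrt (Real.log N)) ≤
      3 * ((2 : ℝ) ^ ((k : ℝ) / 3) * (3 / 2 : ℝ) ^ k) := by
  refine supportPower_realization_behrend_le N (fun x ℓ => bit (a x ℓ)) (fun y ℓ => bit (b y ℓ))
    (fun z ℓ => bit (c z ℓ)) fun x y z => ?_
  rw [← hreal x y z, supportPower_triangle_iff_good hF]

end Dictionary

end Summit.MatrixMultiplication.MatrixMultiplication.Theorems.SupportSubrank
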